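import Summits.AtomisticToContinuum.BoseEinsteinCondensation.Theorems.ParticleTensorisation.Negative.PosdefDressingShells

/-!
# Crux `ParticleTensorisation` (stmt-AtomisticToContinuum-14367) — `Negative/`:
# the dressed law violates the conclusion clause (file X2)

Toward `¬ stub_posdefDressing`: with the test data `F = A·1{M > 0}` and `g_i = 1{M_i > 0}`
(bounded, measurable, `g_i` blind to `x_i`), the conclusion clause
`∃ c, ∫ |F - cA|² ≤ C ∑_i ∫ |F - g_i A|²` FAILS for the dressed amplitude `A = √w e^{-E/2}` as soon
as the supercritical Curie–Weiss shell `j₁` outweighs the balanced shell `j₀ = ⌈N/2⌉` by more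
than `2e²CN`: the right-hand side only sees configurations with `M ∈ {0, 1}` (one resampled spin
cannot change the sign of `M` otherwise), i.e. the shell `j₀`, while the left-hand side is at
least `(|1-c|² + |c|²) ≥ ½` times the mass of the shell `j₁` (and of its mirror `N - j₁`).
Inputs: the cell/shell bounds of file X1; the shell comparison and the largeness of `N` enter as
hypotheses (`hshell`, `hmirror`, `hbig`), discharged in the assembly from file C.
Rung style (defining hypotheses, no definitions).
-/

noncomputable section

namespace Summit.AtomisticToContinuum.BoseEinsteinCondensation.Theorems.PosdefDressingNeg

open MeasureTheory Function Finset Set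
open scoped ENNReal
open Literature.MathematicalPhysics.QuantumManyBody.BoseGas

/-- `|1 - c|² + |c|² ≥ ½` for every complex `c` (in `ℝ≥0∞`). [folklore] -/
theorem half_le_nnnorm_one_sub_sq_add (c : ℂ) :
    (1 / 2 : ℝ≥0∞) ≤ ((‖1 - c‖₊ : ℝ≥0∞)) ^ 2 + ((‖c‖₊ : ℝ≥0∞)) ^ 2 := by
  have h1 : (1 : ℝ) ≤ ‖1 - c‖ + ‖c‖ := by
    have := norm_add_le (1 - c) c
    rwa [sub_add_cancel, norm_one] at this
  have h2 : (1 / 2 : ℝ) ≤ ‖1 - c‖ ^ 2 + ‖c‖ ^ 2 := by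
    nlinarith [sq_nonneg (‖1 - c‖ - ‖c‖), norm_nonneg (1 - c), norm_nonneg c]
  have h3 : ENNReal.ofReal (1 / 2) ≤ ENNReal.ofReal (‖1 - c‖ ^ 2 + ‖c‖ ^ 2) :=
    ENNReal.ofReal_le_ofReal h2
  rw [ENNReal.ofReal_div_of_pos two_pos, ENNReal.ofReal_one, ENNReal.ofReal_ofNat] at h3
  refine h3.trans_eq ?_
  rw [ENNReal.ofReal_add (sq_nonneg _) (sq_nonneg _), ENNReal.ofReal_pow (norm_nonneg _),
    ENNReal.ofReal_pow (norm_nonneg _), ofReal_norm, ofReal_norm, enorm_eq_nnnorm, enorm_eq_nnnorm]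

section Model

variable {N : ℕ} {a b u : ℝ}
variable {qp qm : Fin N → Fin 3 → ℝ} {Wp Wm : Fin N → Set Space} {s : Space → ℝ}
  {χ : Fin N → Space → ℝ} {M : (Fin N → Space) → ℝ} {Mj : Fin N → (Fin N → Space) → ℝ}
  {w E : (Fin N → Space) → ℝ} {A F : (Fin N → Space) → ℂ} {g : Fin N → (Fin N → Space) → ℂ}

/-- **Pointwise right-hand side bound**: `|F - g_i A|² ≤ 1_{-1 < M ≤ 1} |A|²` — resampling one
spin changes `M` by at most `1` in each direction, so `1{M>0}` and `1{M_i>0}` differ only when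
`M ∈ (-1, 1]`. [folklore] -/
theorem rhs_pointwise (hs : ∀ x, s x = if x 0 < 5 / 4 then 1 else -1)
    (hM : ∀ X, M X = ∑ k, s (X k)) (hMj : ∀ j X, Mj j X = ∑ k ∈ univ.erase j, s (X k))
    (hF : ∀ X, F X = if 0 < M X then A X else 0)
    (hg : ∀ i X, g i X = if 0 < Mj i X then 1 else 0) (i : Fin N) (X : Fin N → Space) :
    ((‖F X - g i X * A X‖₊ : ℝ≥0∞)) ^ 2 ≤
      {X | -1 < M X ∧ M X ≤ 1}.indicator (fun X => ((‖A X‖₊ : ℝ≥0∞)) ^ 2) X := by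
  have hrel := M_eq_Mj_add hM hMj i X
  have hs1 := abs_s_le hs (X i)
  rw [abs_le] at hs1
  rw [hF, hg]
  by_cases h1 : 0 < M X <;> by_cases h2 : 0 < Mj i X
  · rw [if_pos h1, if_pos h2, one_mul, sub_self, nnnorm_zero, ENNReal.coe_zero,
      zero_pow two_ne_zero]
    exact bot_le
  · rw [if_pos h1, if_neg h2, zero_mul, sub_zero,
      Set.indicator_of_mem (show X ∈ {X | -1 < M X ∧ M X ≤ 1} from ⟨by linarith, by linarith⟩)]
  · rw [if_neg h1, if_pos h2, one_mul, zero_sub, nnnorm_neg,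
      Set.indicator_of_mem (show X ∈ {X | -1 < M X ∧ M X ≤ 1} from ⟨by linarith, by linarith⟩)]
  · rw [if_neg h1, if_neg h2, zero_mul, sub_self, nnnorm_zero, ENNReal.coe_zero,
      zero_pow two_ne_zero]
    exact bot_le

/-- **Pointwise left-hand side identity**:
`|F - cA|² = |1-c|² 1{M>0}|A|² + |c|² 1{M≤0}|A|²`. [folklore] -/
theorem lhs_pointwise (hF : ∀ X, F X = if 0 < M X then A X else 0) (c : ℂ) (X : Fin N → Space) :
    ((‖F X - c * A X‖₊ : ℝ≥0∞)) ^ 2 =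
      ((‖1 - c‖₊ : ℝ≥0∞)) ^ 2 * {X | 0 < M X}.indicator (fun X => ((‖A X‖₊ : ℝ≥0∞)) ^ 2) X +
        ((‖c‖₊ : ℝ≥0∞)) ^ 2 * {X | ¬ 0 < M X}.indicator (fun X => ((‖A X‖₊ : ℝ≥0∞)) ^ 2) X := by
  rw [hF]
  by_cases h1 : 0 < M X
  · rw [if_pos h1, Set.indicator_of_mem (show X ∈ {X | 0 < M X} from h1),
      Set.indicator_of_notMem (show X ∉ {X | ¬ 0 < M X} from fun h => h h1), mul_zero, add_zero,
      show A X - c * A X = (1 - c) * A X by ring, nnnorm_mul, ENNReal.coe_mul, mul_pow]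
  · rw [if_neg h1, Set.indicator_of_notMem (show X ∉ {X | 0 < M X} from h1),
      Set.indicator_of_mem (show X ∈ {X | ¬ 0 < M X} from h1), mul_zero, zero_add, zero_sub,
      nnnorm_neg, nnnorm_mul, ENNReal.coe_mul, mul_pow]

/-- **Where the right-hand side lives**: a configuration in the support of `w` with
`-1 < M ≤ 1` lies in a cell `cfg S` with `|S| = ⌈N/2⌉`. [folklore] -/
theorem mem_biUnion_cfg (hs : ∀ x, s x = if x 0 < 5 / 4 then 1 else -1)
    (hqp : ∀ k, qp k = ![1, 1 + (k : ℝ) / N, 1]) (hqm : ∀ k, qm k = ![3 / 2, 1 + (k : ℝ) / N, 1])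
    (hWp : ∀ k, Wp k = {x : Space | ∀ i, x i ∈ Ioo (qp k i) (qp k i + a)})
    (hWm : ∀ k, Wm k = {x : Space | ∀ i, x i ∈ Ioo (qm k i) (qm k i + a)}) (ha : a ≤ 1 / 4)
    (hχ : ∀ k x, χ k x = (Wp k ∪ Wm k).indicator (fun _ => (1 : ℝ)) x)
    (hM : ∀ X, M X = ∑ k, s (X k))
    (hw : ∀ X, w X = (∏ k, χ k (X k)) * Real.exp (b * ((M X) ^ 2 - (N : ℝ) ^ 2) / 2))
    {X : Fin N → Space} (hwX : w X ≠ 0) (hD : -1 < M X ∧ M X ≤ 1) :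
    X ∈ ⋃ S ∈ (Finset.powersetCard ((N + 1) / 2) (Finset.univ : Finset (Fin N))),
      Set.pi Set.univ (fun k => if k ∈ S then Wp k else Wm k) := by
  classical
  have hwells : ∀ k, X k ∈ Wp k ∪ Wm k := fun k => by
    by_contra h
    exact hwX (w_eq_zero hχ hw h)
  set S₀ : Finset (Fin N) := Finset.univ.filter fun k => X k ∈ Wp k with hS₀
  have hmem : X ∈ Set.pi Set.univ (fun k => if k ∈ S₀ then Wp k else Wm k) := by
    intro k _
    by_cases hk : X k ∈ Wp k
    · have : k ∈ S₀ := by rw [hS₀]; simpa using hk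
      simp only [this, ↓reduceIte]; exact hk
    · have : k ∉ S₀ := by rw [hS₀]; simpa using hk
      simp only [this, ↓reduceIte]
      exact (hwells k).resolve_left hk
  have hMS := M_eq_of_mem_cfg hs hqp hqm hWp hWm ha hM S₀ hmem
  have hcard : S₀.card = (N + 1) / 2 := by
    have h1 : (N : ℝ) < 2 * S₀.card + 1 := by linarith [hD.1]
    have h2 : 2 * (S₀.card : ℝ) ≤ N + 1 := by linarith [hD.2]
    have h1' : N < 2 * S₀.card + 1 := by exact_mod_cast h1
    have h2' : 2 * S₀.card ≤ N + 1 := by exact_mod_cast h2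
    omega
  refine Set.mem_iUnion₂.mpr ⟨S₀, ?_, hmem⟩
  exact Finset.mem_powersetCard.mpr ⟨Finset.subset_univ _, hcard⟩

/-- **The dressed law violates the conclusion clause.** See the module docstring. [folklore] -/
theorem cw_not_clause (hN : 2 ≤ N)
    (hs : ∀ x, s x = if x 0 < 5 / 4 then 1 else -1)
    (hqp : ∀ k, qp k = ![1, 1 + (k : ℝ) / N, 1]) (hqm : ∀ k, qm k = ![3 / 2, 1 + (k : ℝ) / N, 1])
    (hWp : ∀ k, Wp k = {x : Space | ∀ i, x i ∈ Ioo (qp k i) (qp k i + a)})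
    (hWm : ∀ k, Wm k = {x : Space | ∀ i, x i ∈ Ioo (qm k i) (qm k i + a)})
    (ha0 : 0 < a) (ha : a ≤ 1 / 4)
    (hχ : ∀ k x, χ k x = (Wp k ∪ Wm k).indicator (fun _ => (1 : ℝ)) x)
    (hM : ∀ X, M X = ∑ k, s (X k)) (hMj : ∀ j X, Mj j X = ∑ k ∈ univ.erase j, s (X k))
    (hw : ∀ X, w X = (∏ k, χ k (X k)) * Real.exp (b * ((M X) ^ 2 - (N : ℝ) ^ 2) / 2))
    (hA : ∀ X, A X = ((Real.sqrt (w X) * Real.exp (-(E X) / 2) : ℝ) : ℂ))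
    (hEapprox : ∀ X, (∀ k, X k ∈ Wp k ∪ Wm k) →
      |E X + u / ((N : ℝ) - 1) * ((M X) ^ 2 - N) / 2| ≤ 1)
    (hAm : Measurable A) (hMm : Measurable M)
    (hF : ∀ X, F X = if 0 < M X then A X else 0)
    (hg : ∀ i X, g i X = if 0 < Mj i X then 1 else 0)
    {C : ℝ} (hC : 0 ≤ C) {j₁ : ℕ} (hj₁ : (N + 1) / 2 < j₁) (hj₁N : j₁ ≤ N) {R : ℝ}
    (hshell : R * ((N.choose ((N + 1) / 2) : ℝ) *
        Real.exp ((b * N + u * N / ((N : ℝ) - 1)) / (2 * N) * ((2 * ((N + 1) / 2 : ℕ) - N : ℝ) ^ 2 - N)))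
      ≤ (N.choose j₁ : ℝ) * Real.exp ((b * N + u * N / ((N : ℝ) - 1)) / (2 * N) * ((2 * j₁ - N : ℝ) ^ 2 - N)))
    (hbig : 2 * Real.exp 2 * C * N < R) :
    ¬ ∃ c : ℂ, (∫⁻ X in boxN N 3, (‖F X - c * A X‖₊ : ℝ≥0∞) ^ 2) ≤
        ENNReal.ofReal C * ∑ i : Fin N, ∫⁻ X in boxN N 3, (‖F X - g i X * A X‖₊ : ℝ≥0∞) ^ 2 := by
  classical
  rintro ⟨c, hc⟩
  have hNpos : 0 < N := by omega
  have hNr : (2 : ℝ) ≤ N := by exact_mod_cast hN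
  have hN1 : (0 : ℝ) < (N : ℝ) - 1 := by linarith
  -- abbreviations
  set V : ℝ≥0∞ := (ENNReal.ofReal a ^ 3) ^ N with hV
  have hV0 : V ≠ 0 := pow_ne_zero _ (pow_ne_zero _ ((ENNReal.ofReal_pos.mpr ha0).ne'))
  have hVtop : V ≠ ⊤ := ENNReal.pow_ne_top (ENNReal.pow_ne_top ENNReal.ofReal_ne_top)
  set Φ : ℕ → ℝ := fun j => b * ((2 * (j : ℝ) - N) ^ 2 - (N : ℝ) ^ 2) / 2 +
    u / ((N : ℝ) - 1) * ((2 * (j : ℝ) - N) ^ 2 - N) / 2 with hΦ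
  set j₀ : ℕ := (N + 1) / 2 with hj₀
  set cfg : Finset (Fin N) → Set (Fin N → Space) :=
    fun S => Set.pi Set.univ (fun k => if k ∈ S then Wp k else Wm k) with hcfg
  have shells := fun S : Finset (Fin N) =>
    setLIntegral_cfg_bounds (u := u) hs hqp hqm hWp hWm ha hχ hM hw hA hEapprox S
  have hAsq_meas : Measurable fun X => ((‖A X‖₊ : ℝ≥0∞)) ^ 2 :=
    hAm.nnnorm.coe_nnreal_ennreal.pow_const 2
  -- Step 1: the right-hand side is at most `C · N · d`, `d = ∫_{Λ^N} 1_{-1<M≤1} |A|²`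
  set D : Set (Fin N → Space) := {X | -1 < M X ∧ M X ≤ 1} with hDdef
  set d : ℝ≥0∞ := ∫⁻ X in boxN N 3, D.indicator (fun X => ((‖A X‖₊ : ℝ≥0∞)) ^ 2) X with hd
  have hRHS : ∑ i : Fin N, ∫⁻ X in boxN N 3, (‖F X - g i X * A X‖₊ : ℝ≥0∞) ^ 2 ≤ (N : ℝ≥0∞) * d := by
    calc ∑ i : Fin N, ∫⁻ X in boxN N 3, (‖F X - g i X * A X‖₊ : ℝ≥0∞) ^ 2
        ≤ ∑ _i : Fin N, d := Finset.sum_le_sum fun i _ =>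
          lintegral_mono fun X => rhs_pointwise hs hM hMj hF hg i X
      _ = (N : ℝ≥0∞) * d := by
          rw [Finset.sum_const, Finset.card_univ, Fintype.card_fin, nsmul_eq_mul]
  -- Step 2: `d ≤ C(N,j₀) V e^{Φ(j₀)+1}`
  set T₀ : Finset (Finset (Fin N)) := Finset.powersetCard j₀ Finset.univ with hT₀
  have hd_le : d ≤ (N.choose j₀ : ℝ≥0∞) * (V * ENNReal.ofReal (Real.exp (Φ j₀ + 1))) := by
    have hpt : ∀ X, D.indicator (fun X => ((‖A X‖₊ : ℝ≥0∞)) ^ 2) X ≤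
        (⋃ S ∈ T₀, cfg S).indicator (fun X => ((‖A X‖₊ : ℝ≥0∞)) ^ 2) X := by
      intro X
      by_cases hXD : X ∈ D
      · rw [Set.indicator_of_mem hXD]
        by_cases hA0 : ((‖A X‖₊ : ℝ≥0∞)) ^ 2 = 0
        · rw [hA0]; exact bot_le
        · have hwX : w X ≠ 0 := by
            intro h0
            apply hA0
            rw [hA, h0, Real.sqrt_zero, zero_mul, Complex.ofReal_zero, nnnorm_zero, ENNReal.coe_zero,
              zero_pow two_ne_zero]
          rw [Set.indicator_of_mem (mem_biUnion_cfg hs hqp hqm hWp hWm ha hχ hM hw hwX hXD)]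
      · rw [Set.indicator_of_notMem hXD]; exact bot_le
    have hmeasU : MeasurableSet (⋃ S ∈ T₀, cfg S) :=
      MeasurableSet.biUnion (Finset.countable_toSet _) fun S _ => measurableSet_cfg hWp hWm S
    calc d ≤ ∫⁻ X in boxN N 3, (⋃ S ∈ T₀, cfg S).indicator (fun X => ((‖A X‖₊ : ℝ≥0∞)) ^ 2) X :=
          lintegral_mono hpt
      _ ≤ ∫⁻ X, (⋃ S ∈ T₀, cfg S).indicator (fun X => ((‖A X‖₊ : ℝ≥0∞)) ^ 2) X :=
          setLIntegral_le_lintegral _ _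
      _ = ∫⁻ X in ⋃ S ∈ T₀, cfg S, ((‖A X‖₊ : ℝ≥0∞)) ^ 2 := lintegral_indicator hmeasU _
      _ = ∑ S ∈ T₀, ∫⁻ X in cfg S, ((‖A X‖₊ : ℝ≥0∞)) ^ 2 :=
          lintegral_biUnion_finset (pairwiseDisjoint_cfg hqp hqm hWp hWm ha T₀)
            (fun S _ => measurableSet_cfg hWp hWm S) _
      _ ≤ ∑ _S ∈ T₀, V * ENNReal.ofReal (Real.exp (Φ j₀ + 1)) := Finset.sum_le_sum fun S hS => by
          have hcardS : S.card = j₀ := (Finset.mem_powersetCard.mp hS).2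
          have := (shells S).2
          rw [hcardS] at this
          exact this
      _ = (N.choose j₀ : ℝ≥0∞) * (V * ENNReal.ofReal (Real.exp (Φ j₀ + 1))) := by
          rw [Finset.sum_const, hT₀, Finset.card_powersetCard, Finset.card_univ, Fintype.card_fin,
            nsmul_eq_mul]
  -- Step 3: the left-hand side is at least `(|1-c|²+|c|²) C(N,j₁) V e^{Φ(j₁)-1}`
  set P₀ : ℝ≥0∞ := (N.choose j₁ : ℝ≥0∞) * (V * ENNReal.ofReal (Real.exp (Φ j₁ - 1))) with hP₀
  have hΦsymm : Φ (N - j₁) = Φ j₁ := by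
    simp only [hΦ]
    push_cast [Nat.cast_sub hj₁N]
    ring
  have shell_lower : ∀ (T : Finset (Finset (Fin N))) (jj : ℕ), (∀ S ∈ T, S.card = jj) →
      (∀ S ∈ T, ∀ X ∈ cfg S, (0 < M X ↔ 0 < (2 * (jj : ℝ) - N))) → ∀ (P : (Fin N → Space) → Prop),
      (∀ X, P X ↔ 0 < M X) ∨ (∀ X, P X ↔ ¬ 0 < M X) →
      (∀ S ∈ T, ∀ X ∈ cfg S, P X) →
      (T.card : ℝ≥0∞) * (V * ENNReal.ofReal (Real.exp (Φ jj - 1))) ≤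
        ∫⁻ X in boxN N 3, {X | P X}.indicator (fun X => ((‖A X‖₊ : ℝ≥0∞)) ^ 2) X := by
    intro T jj hcardT _ P _ hPT
    have hmeasU : MeasurableSet (⋃ S ∈ T, cfg S) :=
      MeasurableSet.biUnion (Finset.countable_toSet _) fun S _ => measurableSet_cfg hWp hWm S
    have hUsub : (⋃ S ∈ T, cfg S) ⊆ boxN N 3 := Set.iUnion₂_subset fun S _ =>
      cfg_subset_boxN hqp hqm hWp hWm ha0 ha S
    calc (T.card : ℝ≥0∞) * (V * ENNReal.ofReal (Real.exp (Φ jj - 1)))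
        = ∑ _S ∈ T, V * ENNReal.ofReal (Real.exp (Φ jj - 1)) := by
          rw [Finset.sum_const, nsmul_eq_mul]
      _ ≤ ∑ S ∈ T, ∫⁻ X in cfg S, ((‖A X‖₊ : ℝ≥0∞)) ^ 2 := Finset.sum_le_sum fun S hS => by
          have := (shells S).1
          rw [hcardT S hS] at this
          exact this
      _ = ∫⁻ X in ⋃ S ∈ T, cfg S, ((‖A X‖₊ : ℝ≥0∞)) ^ 2 :=
          (lintegral_biUnion_finset (pairwiseDisjoint_cfg hqp hqm hWp hWm ha T)
            (fun S _ => measurableSet_cfg hWp hWm S) _).symm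
      _ = ∫⁻ X in ⋃ S ∈ T, cfg S, {X | P X}.indicator (fun X => ((‖A X‖₊ : ℝ≥0∞)) ^ 2) X := by
          refine setLIntegral_congr_fun hmeasU (fun X hX => ?_)
          obtain ⟨S, hS, hXS⟩ := Set.mem_iUnion₂.mp hX
          rw [Set.indicator_of_mem (show X ∈ {X | P X} from hPT S hS X hXS)]
      _ ≤ ∫⁻ X in boxN N 3, {X | P X}.indicator (fun X => ((‖A X‖₊ : ℝ≥0∞)) ^ 2) X :=
          lintegral_mono_set hUsub
  set T₁ : Finset (Finset (Fin N)) := Finset.powersetCard j₁ Finset.univ with hT₁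
  set T₂ : Finset (Finset (Fin N)) := Finset.powersetCard (N - j₁) Finset.univ with hT₂
  have hj₀2 : N ≤ 2 * j₀ := by rw [hj₀]; omega
  have hM₁pos : (0 : ℝ) < 2 * (j₁ : ℝ) - N := by
    have : N < 2 * j₁ := by omega
    have : (N : ℝ) < 2 * j₁ := by exact_mod_cast this
    linarith
  have hM₂neg : ¬ (0 : ℝ) < 2 * ((N - j₁ : ℕ) : ℝ) - N := by
    push_cast [Nat.cast_sub hj₁N]
    have : (N : ℝ) < 2 * j₁ := by exact_mod_cast (show N < 2 * j₁ by omega)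
    linarith
  have hp : P₀ ≤ ∫⁻ X in boxN N 3, {X | 0 < M X}.indicator (fun X => ((‖A X‖₊ : ℝ≥0∞)) ^ 2) X := by
    have h := shell_lower T₁ j₁ (fun S hS => (Finset.mem_powersetCard.mp hS).2)
      (fun S hS X hX => by
        rw [M_eq_of_mem_cfg hs hqp hqm hWp hWm ha hM S hX, (Finset.mem_powersetCard.mp hS).2])
      (fun X => 0 < M X) (Or.inl fun X => Iff.rfl)
      (fun S hS X hX => by
        show 0 < M X
        rw [M_eq_of_mem_cfg hs hqp hqm hWp hWm ha hM S hX, (Finset.mem_powersetCard.mp hS).2]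
        exact hM₁pos)
    rw [hT₁, Finset.card_powersetCard, Finset.card_univ, Fintype.card_fin] at h
    exact h
  have hq : P₀ ≤ ∫⁻ X in boxN N 3, {X | ¬ 0 < M X}.indicator (fun X => ((‖A X‖₊ : ℝ≥0∞)) ^ 2) X := by
    have h := shell_lower T₂ (N - j₁) (fun S hS => (Finset.mem_powersetCard.mp hS).2)
      (fun S hS X hX => by
        rw [M_eq_of_mem_cfg hs hqp hqm hWp hWm ha hM S hX, (Finset.mem_powersetCard.mp hS).2])
      (fun X => ¬ 0 < M X) (Or.inr fun X => Iff.rfl)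
      (fun S hS X hX => by
        show ¬ 0 < M X
        rw [M_eq_of_mem_cfg hs hqp hqm hWp hWm ha hM S hX, (Finset.mem_powersetCard.mp hS).2]
        exact hM₂neg)
    rw [hT₂, Finset.card_powersetCard, Finset.card_univ, Fintype.card_fin, Nat.choose_symm hj₁N,
      hΦsymm] at h
    exact h
  have hLHS : (1 / 2 : ℝ≥0∞) * P₀ ≤ ∫⁻ X in boxN N 3, (‖F X - c * A X‖₊ : ℝ≥0∞) ^ 2 := by
    have hm1 : Measurable fun X => {X | 0 < M X}.indicator (fun X => ((‖A X‖₊ : ℝ≥0∞)) ^ 2) X :=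
      hAsq_meas.indicator (measurableSet_lt measurable_const hMm)
    calc (1 / 2 : ℝ≥0∞) * P₀ ≤ (((‖1 - c‖₊ : ℝ≥0∞)) ^ 2 + ((‖c‖₊ : ℝ≥0∞)) ^ 2) * P₀ :=
          mul_le_mul_of_nonneg_right (half_le_nnnorm_one_sub_sq_add c) (zero_le)
      _ = ((‖1 - c‖₊ : ℝ≥0∞)) ^ 2 * P₀ + ((‖c‖₊ : ℝ≥0∞)) ^ 2 * P₀ := add_mul _ _ _
      _ ≤ ((‖1 - c‖₊ : ℝ≥0∞)) ^ 2 *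
            (∫⁻ X in boxN N 3, {X | 0 < M X}.indicator (fun X => ((‖A X‖₊ : ℝ≥0∞)) ^ 2) X) +
          ((‖c‖₊ : ℝ≥0∞)) ^ 2 *
            (∫⁻ X in boxN N 3, {X | ¬ 0 < M X}.indicator (fun X => ((‖A X‖₊ : ℝ≥0∞)) ^ 2) X) :=
          add_le_add (mul_le_mul_of_nonneg_left hp (zero_le)) (mul_le_mul_of_nonneg_left hq (zero_le))
      _ = ∫⁻ X in boxN N 3, (((‖1 - c‖₊ : ℝ≥0∞)) ^ 2 *
            {X | 0 < M X}.indicator (fun X => ((‖A X‖₊ : ℝ≥0∞)) ^ 2) X +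
          ((‖c‖₊ : ℝ≥0∞)) ^ 2 *
            {X | ¬ 0 < M X}.indicator (fun X => ((‖A X‖₊ : ℝ≥0∞)) ^ 2) X) := by
          rw [lintegral_add_left (hm1.const_mul _), lintegral_const_mul _ hm1, lintegral_const_mul'']
          exact (hAsq_meas.indicator (measurableSet_lt measurable_const hMm).compl).aemeasurable
      _ = ∫⁻ X in boxN N 3, (‖F X - c * A X‖₊ : ℝ≥0∞) ^ 2 :=
          lintegral_congr fun X => (lhs_pointwise hF c X).symm
  -- Step 4: the numbers
  have hchain : (1 / 2 : ℝ≥0∞) * P₀ ≤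
      ENNReal.ofReal C * ((N : ℝ≥0∞) * ((N.choose j₀ : ℝ≥0∞) * (V * ENNReal.ofReal (Real.exp (Φ j₀ + 1))))) :=
    hLHS.trans (hc.trans (mul_le_mul_of_nonneg_left (hRHS.trans
      (mul_le_mul_of_nonneg_left hd_le (zero_le))) (zero_le)))
  -- rewrite both sides as `V * ofReal (real)`
  have hW₀ : 0 < (N.choose j₀ : ℝ) * Real.exp ((b * N + u * N / ((N : ℝ) - 1)) / (2 * N) *
      ((2 * (j₀ : ℝ) - N) ^ 2 - N)) :=
    mul_pos (by exact_mod_cast Nat.choose_pos (by omega)) (Real.exp_pos _)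
  have hΦW : ∀ j : ℕ, Φ j = (b * N + u * N / ((N : ℝ) - 1)) / (2 * N) * ((2 * (j : ℝ) - N) ^ 2 - N) +
      b * ((N : ℝ) - (N : ℝ) ^ 2) / 2 := by
    intro j
    simp only [hΦ]
    field_simp
    ring
  have lhs_eq : (1 / 2 : ℝ≥0∞) * P₀ = V * ENNReal.ofReal ((N.choose j₁ : ℝ) * Real.exp (Φ j₁ - 1) / 2) := by
    rw [hP₀, ENNReal.ofReal_div_of_pos two_pos, ENNReal.ofReal_mul (by positivity),
      ENNReal.ofReal_natCast, ENNReal.ofReal_ofNat]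
    simp only [div_eq_mul_inv, one_mul]
    ring
  have rhs_eq : ENNReal.ofReal C * ((N : ℝ≥0∞) * ((N.choose j₀ : ℝ≥0∞) *
      (V * ENNReal.ofReal (Real.exp (Φ j₀ + 1))))) =
      V * ENNReal.ofReal (C * N * ((N.choose j₀ : ℝ) * Real.exp (Φ j₀ + 1))) := by
    rw [ENNReal.ofReal_mul (by positivity), ENNReal.ofReal_mul hC, ENNReal.ofReal_mul (by positivity),
      ENNReal.ofReal_natCast, ENNReal.ofReal_natCast]
    ring
  rw [lhs_eq, rhs_eq] at hchain
  have hreal : C * N * ((N.choose j₀ : ℝ) * Real.exp (Φ j₀ + 1)) <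
      (N.choose j₁ : ℝ) * Real.exp (Φ j₁ - 1) / 2 := by
    rw [hΦW j₀, hΦW j₁]
    set W₀ : ℝ := (N.choose j₀ : ℝ) * Real.exp ((b * N + u * N / ((N : ℝ) - 1)) / (2 * N) *
      ((2 * (j₀ : ℝ) - N) ^ 2 - N)) with hW₀def
    set W₁ : ℝ := (N.choose j₁ : ℝ) * Real.exp ((b * N + u * N / ((N : ℝ) - 1)) / (2 * N) *
      ((2 * (j₁ : ℝ) - N) ^ 2 - N)) with hW₁def
    set K : ℝ := Real.exp (b * ((N : ℝ) - (N : ℝ) ^ 2) / 2) with hK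
    have hK0 : 0 < K := Real.exp_pos _
    have hshell' : R * W₀ ≤ W₁ := by
      have : (2 * ((N + 1) / 2 : ℕ) - N : ℝ) = 2 * (j₀ : ℝ) - N := by rw [hj₀]
      rw [hW₀def, hW₁def, ← this]
      exact hshell
    have e1 : C * N * ((N.choose j₀ : ℝ) * Real.exp ((b * N + u * N / ((N : ℝ) - 1)) / (2 * N) *
        ((2 * (j₀ : ℝ) - N) ^ 2 - N) + b * ((N : ℝ) - (N : ℝ) ^ 2) / 2 + 1)) =
        C * N * Real.exp 1 * K * W₀ := by
      rw [Real.exp_add, Real.exp_add, hW₀def, hK]; ring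
    have e2 : (N.choose j₁ : ℝ) * Real.exp ((b * N + u * N / ((N : ℝ) - 1)) / (2 * N) *
        ((2 * (j₁ : ℝ) - N) ^ 2 - N) + b * ((N : ℝ) - (N : ℝ) ^ 2) / 2 - 1) / 2 =
        (Real.exp 1)⁻¹ * K * W₁ / 2 := by
      rw [Real.exp_sub, Real.exp_add, hW₁def, hK]; ring
    rw [e1, e2]
    have hE2 : Real.exp 2 = Real.exp 1 * Real.exp 1 := by rw [← Real.exp_add]; norm_num
    have he1 : 0 < Real.exp 1 := Real.exp_pos 1
    -- `C N e K W₀ < e⁻¹ K W₁ / 2` ⟸ `2 e² C N W₀ < R W₀ ≤ W₁`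
    have h1 : 2 * Real.exp 2 * C * N * W₀ < W₁ := by
      have := mul_le_mul_of_nonneg_right (le_of_lt hbig) hW₀.le
      nlinarith [hW₀]
    rw [hE2] at h1
    rw [lt_div_iff₀ two_pos]
    have h2 : C * N * Real.exp 1 * K * W₀ * 2 * Real.exp 1 < K * W₁ := by nlinarith [hK0, he1]
    calc C * N * Real.exp 1 * K * W₀ * 2
        = (C * N * Real.exp 1 * K * W₀ * 2 * Real.exp 1) * (Real.exp 1)⁻¹ := by
          field_simp
      _ < K * W₁ * (Real.exp 1)⁻¹ := by gcongr
      _ = (Real.exp 1)⁻¹ * K * W₁ := by ring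
  have hlt : V * ENNReal.ofReal (C * N * ((N.choose j₀ : ℝ) * Real.exp (Φ j₀ + 1))) <
      V * ENNReal.ofReal ((N.choose j₁ : ℝ) * Real.exp (Φ j₁ - 1) / 2) := by
    exact ENNReal.mul_lt_mul_right hV0 hVtop
      ((ENNReal.ofReal_lt_ofReal_iff_of_nonneg (by positivity)).mpr hreal)
  exact absurd (hchain.trans_lt hlt) (lt_irrefl _)

end Model

end Summit.AtomisticToContinuum.BoseEinsteinCondensation.Theorems.PosdefDressingNeg

end
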